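import Literature.NumberTheory.Automorphic.BrandtXiGenus
import Literature.NumberTheory.Automorphic.ConnectingIdeal
import Literature.NumberTheory.Automorphic.BrandtDataRingEquiv
import HarnessLib

/-!
# `ξ(N⁺, N⁻)` does not depend on the Brandt setup, given the classical local inputs

Topic `NumberTheory/Automorphic`; theorems only (no definition, no named fact, no instance).
`brandtXi N⁺ N⁻ λ` (`BrandtXi.lean`) is `S.xi λ` for a Brandt setup `S` of type `(N⁺, N⁻)` chosen
by `Classical.choice`; that the value is the same for every setup is Pollack–Weston's tacit
"`ξ_f(N⁺, N⁻)` is well defined" (2011, §2.1). This file assembles the three invariance statements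
of the tree into that independence, *modulo the classical arithmetic inputs it genuinely needs*:

* `BrandtDataRingEquiv.lean`: `xiOfOrder e(O) = xiOfOrder O` for a ring isomorphism `e`;
* `ConnectingIdeal.lean`: locally conjugate orders are connected by an invertible ideal;
* `BrandtXiGenus.lean`: `xiOfOrder O_ℓ(I) = xiOfOrder O` for an invertible right `O`-ideal `I`.

Results:

* `Brandt.xiOfOrder_eq_of_locallyConjugate` — in a totally definite quaternion algebra over `ℚ`,
  two `ℤ`-orders which are conjugate locally at every prime (by units of the algebra, equal
  outside a finite set) have the same `xiOfOrder`;
* `Brandt.XiSetup.xi_eq_of_locallyConjugate` — **two Brandt setups `S, S'` of type `(N⁺, N⁻)`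
  have the same `ξ` as soon as an isomorphism `e : S.D ≃+* S'.D` makes `e(S.O)` and `S'.O`
  locally conjugate**;
* `Brandt.XiSetup.xi_eq_brandtXi_of_locallyConjugate` — hence `S'.xi λ = brandtXi N⁺ N⁻ λ` for
  every setup `S'` so related to the chosen one.

What is *not* proved here (and is exactly what remains for unconditional independence): the
uniqueness of the quaternion algebra over `ℚ` with given ramification (the tree's named fact
`nonempty_algEquiv_of_ramifiedPlaces_eq`, Vignéras III Thm. 3.1) and the local conjugacy of
Eichler orders of the same level (Vignéras II Thm. 2.3, Hijikata; at the ramified primes it is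
the tree's `IsMaximalZOrder.localAt_eq_of_not_isSplitAt`).

## References

* R. Pollack, T. Weston, *On anticyclotomic μ-invariants of modular forms*, Compos. Math. 147
  (2011), §2.1 [PollackWeston2011].
* M.-F. Vignéras, *Arithmétique des algèbres de quaternions*, LNM 800 (1980), Ch. III §5 B
  [VignerasLNM800].
-/

noncomputable section

open scoped Pointwise

universe u

namespace Literature.NumberTheory.Automorphic

namespace Brandt

variable {D : Type u} [Ring D] [Algebra ℚ D] [IsQuaternionAlgebra ℚ D]

/-- **Locally conjugate orders of a totally definite quaternion algebra over `ℚ` have the same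
`ξ`.** If `O` is a `ℤ`-order and `O'` satisfies `O'_(q) = x_q O_(q) x_q⁻¹` (`x_q ∈ Dˣ`) for the
primes `q` of a finite set `S` and `O'_(q) = O_(q)` for the other primes, then
`xiOfOrder O' N λ = xiOfOrder O N λ` (a connecting ideal exists, `ConnectingIdeal.lean`, and `ξ`
is constant on a genus, `BrandtXiGenus.lean`). [cite: VignerasLNM800, Ch. III §5 B] -/
theorem xiOfOrder_eq_of_locallyConjugate (hdef : IsTotallyDefinite ℚ D) {O O' : Submodule ℤ D}
    (hO : IsOrder D O) (x : ℕ → Dˣ) (S : Finset ℕ) (hS : ∀ q ∈ S, q.Prime)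
    (hconj : ∀ q ∈ S, localAt q O' = x q • (MulOpposite.op (((x q)⁻¹ : Dˣ) : D) • localAt q O))
    (heq : ∀ q : ℕ, q.Prime → q ∉ S → localAt q O' = localAt q O) (N : ℕ) (lam : ℕ → ℤ) :
    xiOfOrder O' N lam = xiOfOrder O N lam := by
  have hOZ : IsZOrder O := isZOrder_iff_isOrder.mpr hO
  obtain ⟨I, hI, hI'⟩ := exists_isInvertibleRightIdeal_leftOrderOf_eq hOZ x S hS hconj heq
  have hImem : I ∈ rightIdeals O := by
    rw [rightIdeals_eq_invertibleRightIdeals_of_isTotallyDefinite hdef hOZ]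
    exact hI
  rw [← xiOfOrder_leftOrder_eq hdef hO hImem N lam]
  -- `leftOrder I = leftOrderOf I = O'`
  exact congrArg (fun M => xiOfOrder M N lam) hI'.symm

variable {Nplus Nminus : ℕ}

/-- **Two Brandt setups of type `(N⁺, N⁻)` related by an isomorphism of algebras under which
their Eichler orders become locally conjugate have the same `ξ`.** [cite: PollackWeston2011, §2.1] -/
theorem XiSetup.xi_eq_of_locallyConjugate (S S' : XiSetup Nplus Nminus) (e : S.D ≃+* S'.D)
    (x : ℕ → S'.Dˣ) (T : Finset ℕ) (hT : ∀ q ∈ T, q.Prime)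
    (hconj : ∀ q ∈ T, localAt q S'.O =
      x q • (MulOpposite.op (((x q)⁻¹ : S'.Dˣ) : S'.D) •
        localAt q (S.O.map (e.toAddEquiv.toIntLinearEquiv : S.D →ₗ[ℤ] S'.D))))
    (heq : ∀ q : ℕ, q.Prime → q ∉ T →
      localAt q S'.O = localAt q (S.O.map (e.toAddEquiv.toIntLinearEquiv : S.D →ₗ[ℤ] S'.D)))
    (lam : ℕ → ℤ) : S'.xi lam = S.xi lam := by
  have hO₁ : IsOrder S'.D (S.O.map (e.toAddEquiv.toIntLinearEquiv : S.D →ₗ[ℤ] S'.D)) :=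
    (S.isEichlerOrder.map_ringEquiv e).isOrder
  rw [XiSetup.xi, XiSetup.xi,
    xiOfOrder_eq_of_locallyConjugate S'.isTotallyDefinite hO₁ x T hT hconj heq,
    xiOfOrder_map_ringEquiv]

/-- Hence every setup so related to the chosen one computes `brandtXi`:
`S'.xi λ = brandtXi N⁺ N⁻ λ`. [cite: PollackWeston2011, §2.1] -/
theorem XiSetup.xi_eq_brandtXi_of_locallyConjugate (S' : XiSetup Nplus Nminus)
    (h : ∀ S : XiSetup Nplus Nminus, ∃ (e : S.D ≃+* S'.D) (x : ℕ → S'.Dˣ) (T : Finset ℕ),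
      (∀ q ∈ T, q.Prime) ∧
      (∀ q ∈ T, localAt q S'.O =
        x q • (MulOpposite.op (((x q)⁻¹ : S'.Dˣ) : S'.D) •
          localAt q (S.O.map (e.toAddEquiv.toIntLinearEquiv : S.D →ₗ[ℤ] S'.D)))) ∧
      ∀ q : ℕ, q.Prime → q ∉ T →
        localAt q S'.O = localAt q (S.O.map (e.toAddEquiv.toIntLinearEquiv : S.D →ₗ[ℤ] S'.D)))
    (lam : ℕ → ℤ) : S'.xi lam = brandtXi Nplus Nminus lam := by
  have hne : Nonempty (XiSetup Nplus Nminus) := ⟨S'⟩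
  rw [brandtXi_eq_xi hne]
  obtain ⟨e, x, T, hT, hconj, heq⟩ := h (Classical.choice hne)
  exact XiSetup.xi_eq_of_locallyConjugate _ S' e x T hT hconj heq lam

end Brandt

end Literature.NumberTheory.Automorphic

end
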